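import Summits.FinalStateConjecture.FinalStateConjecture.Theorems.EIHFluxBalanceInertialRecessionChargeKinematicsClusterAlgebra

/-!
# Route EIHFluxBalance — `InertialRecession`, line `old-light-leaves-the-cone`: charge kinematics,
# XXIII (general-N groundwork: far intervals)

Helper file for the crux `stmt-FinalStateConjecture-10166`
(`Summit.FinalStateConjecture.FinalStateConjecture.Theses.EIHFluxBalance.InertialRecession`), second line
lead, endgame stub `stub_expandingChargeKinematics` (S4: abstract quasi-conserved window charges with the
slack-form window law and the single-hole identification ⇒ Cesàro velocities of the painted centres).
THE ESCAPE SERIES: the endgame for `N = 3` (Case A all-pairs freezing is `ChargeKinematicsAllPairs*`;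
Case B, the escape of a fast hole from a velocity-tight pair, is this series; the assembly is
`ChargeKinematicsThree`).

XXIII — GENERAL-N GROUNDWORK: the budget of a cluster window `min((min_x |φ_x|)/2, c₂s)` on a FAR interval
with several certified externals (`far_interval_budget_le`) and the resulting increment of a cluster member
(`cluster_increment_on_far_interval`, lemma C.3 of the MULTI-ESCAPE design).

Every statement is Mathlib-only real analysis over the stub's verbatim hypotheses ([folklore]); the abstract
charge `P` is arbitrary (adversarial), constrained only by the window law and the identification.
-/

set_option linter.dupNamespace false

noncomputable section

open Filter Set Metric Real
open scoped Topology

namespace Summit.FinalStateConjecture.FinalStateConjecture.Theorems.ChargeKinematics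

open Literature.Geometry.Lorentzian

/-! ## The budget on a far interval -/

section FarBudget

open MeasureTheory intervalIntegral

/-- **Budget on a far interval.** Along the cluster window radius `min((min_x |φ_x|)/2, c₂s)` — `x` over a
nonempty finite set of certified externals (`φ_x' ≥ g_x > 0`), all with `|φ_x| ≥ 2m₀` on the interval — the
budget is at most the sum of the passage budgets of the externals. [folklore] -/
theorem far_interval_budget_le {ι : Type*} (S : Finset ι) (hS : S.Nonempty) {φ φ' : ι → ℝ → ℝ}
    {g : ι → ℝ} {t₀ τ m₀ c₂ : ℝ} (ht₀ : 0 < t₀) (hτ : t₀ ≤ τ) (hm₀ : 1 ≤ m₀) (hc₂ : 0 < c₂)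
    (hct : 1 ≤ c₂ * t₀) (hg : ∀ j ∈ S, 0 < g j)
    (hφ : ∀ j ∈ S, ∀ s, HasDerivAt (φ j) (φ' j s) s) (hφ' : ∀ j ∈ S, Continuous (φ' j))
    (hmono : ∀ j ∈ S, ∀ s ∈ Set.Icc t₀ τ, g j ≤ φ' j s)
    (hbig : ∀ j ∈ S, ∀ s ∈ Set.Icc t₀ τ, 2 * m₀ ≤ |φ j s|) :
    ∫ s in t₀..τ, (((min ((S.inf' hS fun j ↦ |φ j s|) / 2) (c₂ * s)) ^ 2)⁻¹ +
        ((min ((S.inf' hS fun j ↦ |φ j s|) / 2) (c₂ * s)) ^ (7 / 4 : ℝ))⁻¹) ≤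
      ∑ j ∈ S, (9 * (2 * 2 * m₀ ^ (1 - 2 : ℝ) / ((2 - 1) * g j)) +
        (3 : ℝ) ^ (7 / 4 : ℝ) * (2 * (7 / 4) * m₀ ^ (1 - 7 / 4 : ℝ) / ((7 / 4 - 1) * g j)) +
        ((c₂ ^ 2 * t₀)⁻¹ + 4 / 3 * c₂ ^ (-(7 / 4) : ℝ) * t₀ ^ (-(3 / 4) : ℝ))) := by
  have hm₀pos : 0 < m₀ := one_pos.trans_le hm₀
  have hφc : ∀ j ∈ S, Continuous (φ j) := fun j hj ↦
    continuous_iff_continuousAt.mpr fun s ↦ (hφ j hj s).continuousAt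
  -- the radius and the clipped one-external radii
  have hRc : Continuous fun s ↦ min ((S.inf' hS fun j ↦ |φ j s|) / 2) (c₂ * s) :=
    ((Continuous.finset_inf'_apply hS fun j hj ↦ (hφc j hj).abs).div_const 2).min
      (continuous_const.mul continuous_id)
  have hc : ∀ j ∈ S, Continuous (fun s ↦ max 1 (min (|φ j s| / 2) (c₂ * s))) := fun j hj ↦
    continuous_const.max (((hφc j hj).abs.div_const 2).min (continuous_const.mul continuous_id))
  have hR1 : ∀ s ∈ Set.Icc t₀ τ, 1 ≤ min ((S.inf' hS fun j ↦ |φ j s|) / 2) (c₂ * s) := by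
    intro s hs
    refine le_min ?_ ?_
    · rw [le_div_iff₀ (by norm_num : (0 : ℝ) < 2)]
      refine (Finset.le_inf'_iff hS _).mpr fun j hj ↦ ?_
      linarith [hbig j hj s hs]
    · nlinarith [hs.1]
  have hex : ∀ s ∈ Set.Icc t₀ τ, ∃ j ∈ S,
      max 1 (min (|φ j s| / 2) (c₂ * s)) ≤ min ((S.inf' hS fun j ↦ |φ j s|) / 2) (c₂ * s) := by
    intro s hs
    obtain ⟨j, hj, hjeq⟩ := Finset.exists_mem_eq_inf' hS (fun j ↦ |φ j s|)
    refine ⟨j, hj, max_le (hR1 s hs) ?_⟩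
    rw [hjeq]
  have hdom := integral_budget_le_sum S (R := fun s ↦ min ((S.inf' hS fun j ↦ |φ j s|) / 2) (c₂ * s))
    (Rp := fun j s ↦ max 1 (min (|φ j s| / 2) (c₂ * s))) hτ hRc.continuousOn hc hR1
    (fun j _ s ↦ le_max_left _ _) hex
  refine hdom.trans (Finset.sum_le_sum fun j hj ↦ ?_)
  refine passage_budget_le ht₀ hτ hm₀pos hc₂ (hg j hj) (hc j hj).continuousOn (fun s _ ↦ le_max_left _ _)
    (fun s hs ↦ ?_) (hφ j hj) (hφ' j hj) (hmono j hj)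
  have hb := hbig j hj s hs
  have hmax : max m₀ |φ j s| = |φ j s| := max_eq_right (by linarith)
  rw [hmax]
  exact le_trans (min_le_min (by linarith [abs_nonneg (φ j s)]) le_rfl) (le_max_right _ _)

end FarBudget

/-! ## The increment of a cluster member on a far interval -/

section FarIncrement

open MeasureTheory intervalIntegral

/-- **Increment of a cluster member on a far interval.** Abstract form: the cluster window law along
`min((min_x |φ_x|)/2, c₂s)` on `[s₁, s₂]` (law with constant `C_w`, error `≤ ε`, identification with the
kinematic cluster charge of `U`), certified externals with `|φ_x| ≥ 2m₀`, internal relative velocities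
`≤ β'` at both ends ⇒ `‖v_a(s₂) − v_a(s₁)‖ ≤ 4(C_w·Σ_x B_x + 3ε)/(Σ_U M) + 2β'`. [folklore] -/
theorem cluster_increment_on_far_interval {ι κι : Type*} (U : Finset ι) {a : ι} (ha : a ∈ U)
    (S : Finset κι) (hS : S.Nonempty) {Mc : ι → ℝ} {v : ι → ℝ → E3} {Qw : ℝ → Fin 4 → ℝ}
    {φ φ' : κι → ℝ → ℝ} {g : κι → ℝ} {ew : ℝ → ℝ} {Cw k s₁ s₂ m₀ c₂ ε β' : ℝ}
    (hk1 : k < 1) (hs₁ : 0 < s₁) (h12 : s₁ ≤ s₂) (hm₀ : 1 ≤ m₀) (hc₂ : 0 < c₂) (hct : 1 ≤ c₂ * s₁)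
    (hCw : 0 ≤ Cw) (hM : ∀ c ∈ U, 0 < Mc c)
    (hvk : ∀ c ∈ U, ‖v c s₁‖ ≤ k ∧ ‖v c s₂‖ ≤ k)
    (hr : ∀ c ∈ U, ‖v c s₁ - v a s₁‖ ≤ β' ∧ ‖v c s₂ - v a s₂‖ ≤ β')
    (hg : ∀ j ∈ S, 0 < g j)
    (hφ : ∀ j ∈ S, ∀ s, HasDerivAt (φ j) (φ' j s) s) (hφ' : ∀ j ∈ S, Continuous (φ' j))
    (hmono : ∀ j ∈ S, ∀ s ∈ Set.Icc s₁ s₂, g j ≤ φ' j s)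
    (hbig : ∀ j ∈ S, ∀ s ∈ Set.Icc s₁ s₂, 2 * m₀ ≤ |φ j s|)
    (hlaw : ∀ μ : Fin 4, |Qw s₂ μ - Qw s₁ μ| ≤
      Cw * (∫ s in s₁..s₂, ((min ((S.inf' hS fun j ↦ |φ j s|) / 2) (c₂ * s)) ^ 2)⁻¹ +
        ((min ((S.inf' hS fun j ↦ |φ j s|) / 2) (c₂ * s)) ^ (7 / 4 : ℝ))⁻¹) + ew s₁)
    (hid : ∀ s, (s = s₁ ∨ s = s₂) → |Qw s 0 - ∑ c ∈ U, Mc c * (√(1 - ‖v c s‖ ^ 2))⁻¹| ≤ ew s ∧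
      ∀ k' : Fin 3, |Qw s k'.succ - ∑ c ∈ U, Mc c * (√(1 - ‖v c s‖ ^ 2))⁻¹ * v c s k'| ≤ ew s)
    (hew : ew s₁ ≤ ε ∧ ew s₂ ≤ ε) :
    ‖v a s₂ - v a s₁‖ ≤ 4 * (Cw * (∑ j ∈ S, (9 * (2 * 2 * m₀ ^ (1 - 2 : ℝ) / ((2 - 1) * g j)) +
        (3 : ℝ) ^ (7 / 4 : ℝ) * (2 * (7 / 4) * m₀ ^ (1 - 7 / 4 : ℝ) / ((7 / 4 - 1) * g j)) +
        ((c₂ ^ 2 * s₁)⁻¹ + 4 / 3 * c₂ ^ (-(7 / 4) : ℝ) * s₁ ^ (-(3 / 4) : ℝ)))) + 3 * ε) /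
        (∑ c ∈ U, Mc c) + 2 * β' := by
  have hB := far_interval_budget_le S hS hs₁ h12 hm₀ hc₂ hct hg hφ hφ' hmono hbig
  have hL : Cw * (∫ s in s₁..s₂, ((min ((S.inf' hS fun j ↦ |φ j s|) / 2) (c₂ * s)) ^ 2)⁻¹ +
      ((min ((S.inf' hS fun j ↦ |φ j s|) / 2) (c₂ * s)) ^ (7 / 4 : ℝ))⁻¹) + ew s₁ ≤
      Cw * (∑ j ∈ S, (9 * (2 * 2 * m₀ ^ (1 - 2 : ℝ) / ((2 - 1) * g j)) +
        (3 : ℝ) ^ (7 / 4 : ℝ) * (2 * (7 / 4) * m₀ ^ (1 - 7 / 4 : ℝ) / ((7 / 4 - 1) * g j)) +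
        ((c₂ ^ 2 * s₁)⁻¹ + 4 / 3 * c₂ ^ (-(7 / 4) : ℝ) * s₁ ^ (-(3 / 4) : ℝ)))) + ε := by
    have := mul_le_mul_of_nonneg_left hB hCw
    linarith only [this, hew.1]
  have h := cluster_velocity_increment_le U ha (W₁ := Qw s₁) (W₂ := Qw s₂) hM
    (fun c hc ↦ one_le_gammaFactor ((hvk c hc).1.trans_lt hk1))
    (fun c hc ↦ one_le_gammaFactor ((hvk c hc).2.trans_lt hk1))
    (fun c hc ↦ (hvk c hc).1.trans hk1.le) (fun c hc ↦ (hr c hc).1) (fun c hc ↦ (hr c hc).2)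
    (hid s₁ (Or.inl rfl)) (hid s₂ (Or.inr rfl)) (fun μ ↦ (hlaw μ).trans hL)
  refine h.trans ?_
  have hMpos : 0 < ∑ c ∈ U, Mc c := Finset.sum_pos hM ⟨a, ha⟩
  have : 4 * (Cw * (∑ j ∈ S, (9 * (2 * 2 * m₀ ^ (1 - 2 : ℝ) / ((2 - 1) * g j)) +
        (3 : ℝ) ^ (7 / 4 : ℝ) * (2 * (7 / 4) * m₀ ^ (1 - 7 / 4 : ℝ) / ((7 / 4 - 1) * g j)) +
        ((c₂ ^ 2 * s₁)⁻¹ + 4 / 3 * c₂ ^ (-(7 / 4) : ℝ) * s₁ ^ (-(3 / 4) : ℝ)))) + ε + ew s₁ + ew s₂) /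
        (∑ c ∈ U, Mc c) ≤
      4 * (Cw * (∑ j ∈ S, (9 * (2 * 2 * m₀ ^ (1 - 2 : ℝ) / ((2 - 1) * g j)) +
        (3 : ℝ) ^ (7 / 4 : ℝ) * (2 * (7 / 4) * m₀ ^ (1 - 7 / 4 : ℝ) / ((7 / 4 - 1) * g j)) +
        ((c₂ ^ 2 * s₁)⁻¹ + 4 / 3 * c₂ ^ (-(7 / 4) : ℝ) * s₁ ^ (-(3 / 4) : ℝ)))) + 3 * ε) /
        (∑ c ∈ U, Mc c) := by
    apply div_le_div_of_nonneg_right _ hMpos.le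
    linarith only [hew.1, hew.2]
  linarith only [this]

end FarIncrement

/-! ## The crude budget of a short interval; one-way linear thresholds -/

section ShortBudget

open MeasureTheory intervalIntegral

/-- **Crude budget of a short interval.** If on `[p, q]` the continuous radius satisfies `R ≥ R_min > 0`,
then `∫(R⁻² + R^{-7/4}) ≤ (q − p)·(R_min⁻² + R_min^{-7/4})`. Used on the NEAR sub-pieces of the general-`N`
analysis, whose length is `O(diam/g)` while `R_min` is a fixed fraction of `diam`. [folklore] -/
theorem short_interval_budget_le {R : ℝ → ℝ} {p q Rmin : ℝ} (hpq : p ≤ q) (hRmin : 0 < Rmin)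
    (hRc : ContinuousOn R (Set.Icc p q)) (hRge : ∀ s ∈ Set.Icc p q, Rmin ≤ R s) :
    ∫ s in p..q, (((R s) ^ 2)⁻¹ + ((R s) ^ (7 / 4 : ℝ))⁻¹) ≤
      (q - p) * ((Rmin ^ 2)⁻¹ + (Rmin ^ (7 / 4 : ℝ))⁻¹) := by
  have hRpos : ∀ s ∈ Set.Icc p q, 0 < R s := fun s hs ↦ hRmin.trans_le (hRge s hs)
  have hpt : ∀ s ∈ Set.Icc p q, ((R s) ^ 2)⁻¹ + ((R s) ^ (7 / 4 : ℝ))⁻¹ ≤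
      (Rmin ^ 2)⁻¹ + (Rmin ^ (7 / 4 : ℝ))⁻¹ := fun s hs ↦
    add_le_add (inv_anti₀ (pow_pos hRmin 2) (pow_le_pow_left₀ hRmin.le (hRge s hs) 2))
      (inv_rpow_le_inv_rpow hRmin (hRge s hs) (by norm_num))
  have hI : IntervalIntegrable (fun s ↦ ((R s) ^ 2)⁻¹ + ((R s) ^ (7 / 4 : ℝ))⁻¹) volume p q := by
    have hRc' : ContinuousOn R (Set.uIcc p q) := by rwa [Set.uIcc_of_le hpq]
    have hne : ∀ s ∈ Set.uIcc p q, R s ≠ 0 := fun s hs ↦ by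
      rw [Set.uIcc_of_le hpq] at hs; exact (hRpos s hs).ne'
    refine ContinuousOn.intervalIntegrable (ContinuousOn.add ?_ ?_)
    · exact (hRc'.pow 2).inv₀ fun s hs ↦ pow_ne_zero 2 (hne s hs)
    · refine (hRc'.rpow_const fun s hs ↦ Or.inr (by norm_num)).inv₀ fun s hs ↦ ?_
      rw [Set.uIcc_of_le hpq] at hs
      exact (Real.rpow_pos_of_pos (hRpos s hs) _).ne'
  calc ∫ s in p..q, (((R s) ^ 2)⁻¹ + ((R s) ^ (7 / 4 : ℝ))⁻¹)
      ≤ ∫ _s in p..q, ((Rmin ^ 2)⁻¹ + (Rmin ^ (7 / 4 : ℝ))⁻¹) :=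
        intervalIntegral.integral_mono_on hpq hI intervalIntegrable_const hpt
    _ = (q - p) * ((Rmin ^ 2)⁻¹ + (Rmin ^ (7 / 4 : ℝ))⁻¹) := by
        rw [intervalIntegral.integral_const, smul_eq_mul]

/-- **One-way crossing of linear thresholds by slow lengths.** If a length `d` has rate `≤ 2θ` on `[t₁, t₂]`
(`|d(s') − d(s)| ≤ 2θ(s' − s)`) and `λ ≥ 4θ`, `0 < t₁`, then `d(s) ≤ λ s` propagates forward: once below the
line `λ s`, always below. (Mechanism (P) of the general-`N` plan: position-cluster merges are one-way.)
[folklore] -/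
theorem below_linear_threshold_forward {d : ℝ → ℝ} {t₁ t₂ θ lam : ℝ} (hlam : 4 * θ ≤ lam)
    (hslow : ∀ s ∈ Set.Icc t₁ t₂, ∀ s' ∈ Set.Icc t₁ t₂, s ≤ s' → |d s' - d s| ≤ 2 * θ * (s' - s))
    {s s' : ℝ} (hs : s ∈ Set.Icc t₁ t₂) (hs' : s' ∈ Set.Icc t₁ t₂) (hss' : s ≤ s')
    (hle : d s ≤ lam * s) : d s' ≤ lam * s' := by
  have h := hslow s hs s' hs' hss'
  rw [abs_le] at h
  nlinarith [h.2]

end ShortBudget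

/-! ## Band-free scale windows -/

section ThickGap

open MeasureTheory intervalIntegral

/-- **Band-free scale window.** For a finite set `H` of heights, a margin `b ≥ 0` with `2b < θ(ρ − 1)`
(`θ > 0`, `ρ ≥ 2`) and more windows than twice the number of heights (`2·H.card < K`), some window
`[θρ^j, θρ^{j+1})` misses every band `[x − b, x + b]`, `x ∈ H`: every height is `< θρ^j − b` or
`≥ θρ^{j+1} + b`. With `b` = (rate of the heights) × (length of a near piece) the side of every height is
then constant along the piece. [folklore] -/
theorem exists_bandfree_scale (H : Finset ℝ) {θ ρ b : ℝ} (hθ : 0 < θ) (hρ : 2 ≤ ρ) (hb : 0 ≤ b)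
    (hbw : 2 * b < θ * (ρ - 1)) {K : ℕ} (hK : 2 * H.card < K) :
    ∃ j : Fin K, ∀ x ∈ H, x + b < θ * ρ ^ (j : ℕ) ∨ θ * ρ ^ ((j : ℕ) + 1) ≤ x - b := by
  classical
  -- the band endpoints
  set H' : Finset ℝ := H.image (fun x ↦ x - b) ∪ H.image (fun x ↦ x + b) with hH'
  have hcard : H'.card < K := by
    calc H'.card ≤ (H.image fun x ↦ x - b).card + (H.image fun x ↦ x + b).card := Finset.card_union_le _ _
      _ ≤ H.card + H.card := add_le_add Finset.card_image_le Finset.card_image_le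
      _ = 2 * H.card := by ring
      _ < K := hK
  obtain ⟨j, hj⟩ := exists_scale_without_height H' hcard
    (fun j : Fin K ↦ Set.Ico (θ * ρ ^ (j : ℕ)) (θ * ρ ^ ((j : ℕ) + 1)))
    (fun j j' hjj' ↦ disjoint_scale_windows hθ (by linarith) j j' hjj')
  refine ⟨j, fun x hx ↦ ?_⟩
  have hlo : x - b ∉ Set.Ico (θ * ρ ^ (j : ℕ)) (θ * ρ ^ ((j : ℕ) + 1)) :=
    hj _ (Finset.mem_union_left _ (Finset.mem_image.mpr ⟨x, hx, rfl⟩))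
  have hhi : x + b ∉ Set.Ico (θ * ρ ^ (j : ℕ)) (θ * ρ ^ ((j : ℕ) + 1)) :=
    hj _ (Finset.mem_union_right _ (Finset.mem_image.mpr ⟨x, hx, rfl⟩))
  simp only [Set.mem_Ico, not_and_or, not_le, not_lt] at hlo hhi
  -- the window is wider than the band: `θρ^j (ρ - 1) ≥ θ(ρ - 1) > 2b`
  have hwidth : 2 * b < θ * ρ ^ ((j : ℕ) + 1) - θ * ρ ^ (j : ℕ) := by
    have hρj : 1 ≤ ρ ^ (j : ℕ) := one_le_pow₀ (by linarith)
    have : θ * ρ ^ ((j : ℕ) + 1) - θ * ρ ^ (j : ℕ) = θ * (ρ - 1) * ρ ^ (j : ℕ) := by ring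
    rw [this]
    have hθρ : 0 < θ * (ρ - 1) := by nlinarith
    nlinarith
  rcases hhi with h | h
  · exact Or.inl h
  · rcases hlo with h' | h'
    · -- `x - b < θρ^j` and `θρ^{j+1} ≤ x + b`: the band would contain the window
      exfalso; linarith
    · exact Or.inr h'

end ThickGap

end Summit.FinalStateConjecture.FinalStateConjecture.Theorems.ChargeKinematics

namespace Summit.FinalStateConjecture.FinalStateConjecture.Theorems

/-- REGISTERED STUB `far_interval_budget_le` of the crux item stmt-FinalStateConjecture-10166 (second line lead, line
`old-light-leaves-the-cone`, S4 escape series): the registered one-line signature verbatim, discharged by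
`ChargeKinematics.far_interval_budget_le`. [folklore] -/
theorem far_interval_budget_le : open Literature.Geometry.Lorentzian Filter Topology MeasureTheory intervalIntegral in ∀ {ι : Type*} (S : Finset ι) (hS : S.Nonempty) {φ φ' : ι → ℝ → ℝ} {g : ι → ℝ} {t₀ τ m₀ c₂ : ℝ} (ht₀ : 0 < t₀) (hτ : t₀ ≤ τ) (hm₀ : 1 ≤ m₀) (hc₂ : 0 < c₂) (hct : 1 ≤ c₂ * t₀) (hg : ∀ j ∈ S, 0 < g j) (hφ : ∀ j ∈ S, ∀ s, HasDerivAt (φ j) (φ' j s) s) (hφ' : ∀ j ∈ S, Continuous (φ' j)) (hmono : ∀ j ∈ S, ∀ s ∈ Set.Icc t₀ τ, g j ≤ φ' j s) (hbig : ∀ j ∈ S, ∀ s ∈ Set.Icc t₀ τ, 2 * m₀ ≤ |φ j s|), ∫ s in t₀..τ, (((min ((S.inf' hS fun j ↦ |φ j s|) / 2) (c₂ * s)) ^ 2)⁻¹ + ((min ((S.inf' hS fun j ↦ |φ j s|) / 2) (c₂ * s)) ^ (7 / 4 : ℝ))⁻¹) ≤ ∑ j ∈ S, (9 * (2 * 2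 * m₀ ^ (1 - 2 : ℝ) / ((2 - 1) * g j)) + (3 : ℝ) ^ (7 / 4 : ℝ) * (2 * (7 / 4) * m₀ ^ (1 - 7 / 4 : ℝ) / ((7 / 4 - 1) * g j)) + ((c₂ ^ 2 * t₀)⁻¹ + 4 / 3 * c₂ ^ (-(7 / 4) : ℝ) * t₀ ^ (-(3 / 4) : ℝ))) :=
  @ChargeKinematics.far_interval_budget_le

end Summit.FinalStateConjecture.FinalStateConjecture.Theorems

end
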